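import Literature.Barriers.HodgeConjecture.HodgeLocusAlgebraicChartedTensorConstructions
import Literature.AlgebraicGeometry.HodgeTheory.VHSDataSubHodgeStructureTranslateLocusDescent
import Literature.AlgebraicGeometry.HodgeTheory.VHSDataProdCharts
import HarnessLib

/-!
# The Cattani–Deligne–Kaplan loci through a covering and for direct sums, as Zariski closedness on points: ANY path-class locus descends
# along a finite étale cover; Corollary 1.4 through a cover; Theorem 1.1 ∕ Corollaries 1.3–1.4 from interior charts DOWNSTAIRS and puncture
# charts UPSTAIRS; Theorem 1.1 ∕ Corollary 1.3 for `Rⁱ f₁,* ℚ ⊕ Rⁱ f₂,* ℚ` from charts of the summands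

[topic Barriers/HodgeConjecture]

Topic `Literature/Barriers/HodgeConjecture` (namespace `Literature.Barriers.HodgeConjecture`), lane `lit-hodgefound` (seat `p08`, row g60-#6).
THEOREMS ONLY: no definition, NO new named fact (the barrier `CattaniDeligneKaplan1995_hodgeLocus_algebraicFor` is the tree's,
`Barriers/HodgeConjecture/HodgeLocusAlgebraic`), no instance, no notation (D-0026 net debt `0`).  JUNCTION of the barrier files
`HodgeLocusAlgebraicFiniteEtaleCover` (descent of Zariski closedness on points along a universally closed `g : S′ ⟶ S` with `g(ℂ)` a covering map) and
`HodgeLocusAlgebraicChartedTensorConstructions` (bundled charts ⟹ Zariski closedness on points over a punctured compact curve) with the generation-60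
chart layer of `HodgeTheory/`: `VHSDataSubHodgeStructureTranslateLocusDescent` (path-class loci and Cor. 1.4 seen from a covering space),
`VHSDataComapCharts` (interior charts pull back to the sheets of a covering: the interior half of «replace `S` by a finite etale covering» is
automatic) and `VHSDataProdCharts` (charts of `D₁ ⊕ D₂` from charts of `D₁`, `D₂`).

PRINTED SOURCES, VERBATIM.  E. Cattani, P. Deligne, A. Kaplan, *On the locus of Hodge classes*, J. AMS 8 (1995) (held text `paper:arxiv-alg-geom_9402009`
p0001–p0002), p. 484: «**Theorem 1.1.** `S^{(K)}` is an algebraic variety, finite over `S`.» (for an ARBITRARY polarized variation `𝒱` — the direct sum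
`𝒱₁ ⊕ 𝒱₂` of two polarized variations of the same weight included); «**Corollary 1.3.** Let `u` be a section of the local system `𝒱_ℤ` on a universal
covering of `S`. The set of points in `S` where some determination of `u` is of type `(0,0)`, is an algebraic subvariety of `S`.»; p. 486: «**Corollary
1.4.** … fix `s ∈ S` and let `U_ℚ ⊂ (𝒱_s)_ℚ` be a rational subspace. The locus where some flat translate of `U_ℚ` is a Hodge substructure is an
algebraic subvariety of `S`.»; p. 485, «Proof of 1.5 ⟹ 1.1»: «To prove 1.1 one is free to replace `S` of 1.1 by a finite etale covering `S′ → S`. …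
the local monodromy of `𝒱` at infinity is unipotent: in a neighborhood of any point in `S̄ − S`, one is in the situation considered in 1.5.»
A. Grothendieck, M. Raynaud, SGA 1, Exp. XII Thm. 5.1 with Prop. 3.1 (iii), 3.2 (vi): a finite étale `g : S′ ⟶ S` over `S` separated gives a finite
topological covering `g(ℂ)` (the tree's `FundamentalGroup.isCoveringMap_map_of_isFinite_of_etale_of_isSeparated`).  B. Moonen, F. Oort, *The Torelli
locus and special subvarieties* (arXiv:1112.0933 p. 9), §3 Def. 4, Rem. 5: finite collections, «the image of this locus in `S`».

* §1 (ANY dimension) **`isZariskiClosedOnPoints_setOf_exists_pathClass_of_comap_covering`** — for `g : S′ ⟶ S` universally closed between `ℂ`-schemes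
  locally of finite type with `g(ℂ)` a covering map, a base point `s′₀ ∈ S′(ℂ)` and ANY property `Q t γ` of path classes `γ : g(s′₀) ⇝ t` in `S(ℂ)`:
  if `{t′ | ∃ γ′ : s′₀ ⇝ t′, Q (g t′) (g ∘ γ′)}` is Zariski closed on points of `S′`, then `{t | ∃ γ, Q t γ}` is Zariski closed on points of `S` (it is the
  image of the former: `HodgeTheory.image_setOf_exists_pathClass_map_eq`; images under a universally closed `g`: `IsZariskiClosedOnPoints.image_map`);
  `…_of_isFinite_of_etale` (`g` finite étale, `S` separated).  The determination loci (`HodgeLocusAlgebraicFiniteEtaleCover` §4), the simultaneous loci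
  and the Cor-1.4 loci below are instances.
* §2 (ANY dimension) COR. 1.4 THROUGH A FINITE ÉTALE COVER: **`isZariskiClosedOnPoints_translateLocus_of_comap_covering`** (`…_of_isFinite_of_etale`) and,
  for finite collections of subspaces in finitely many variations with ONE path class, **`isZariskiClosedOnPoints_setOf_exists_forall_subHodgeStructure_translate_of_comap_covering`**.
* §3 (`dim = 1`) COR. 1.4 ON `S` FROM BUNDLED FLAT CHARTS OF THE PULL-BACK TO A COVER BY A PUNCTURED COMPACT CURVE `φ : T → S(ℂ)`:
  **`isZariskiClosedOnPoints_translateLocus_line_of_isLocallyFlatCharted_cover_of_compactification`** (a line `ℚ·u₀`, flat charts of `φ^*D`),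
  **`isZariskiClosedOnPoints_translateLocus_of_isLocallyFlatCharted_exteriorPower_cover_of_compactification`** (`dim U = d`, flat charts of
  `⋀ᵈ(φ^*D) = φ^*(⋀ᵈD)`), and the finite-collection forms `…_setOf_exists_forall_subHodgeStructure_translate_line_…`, `…_translate_of_exteriorPower_…`.
* §4 (`dim = 1`) FROM INTERIOR CHARTS OF `D` DOWNSTAIRS AND PUNCTURE CHARTS OF `φ^*D` UPSTAIRS ONLY (sheets `e_b` of the covering map `φ`, discs `ψ_a`
  of `S(ℂ)`; the interior charts of `φ^*D` on the charts `ψ_a ∘ e_b` of `T` are induced): the barrier property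
  **`CattaniDeligneKaplan1995_hodgeLocus_algebraicFor_of_sheets_of_compactification`** (Thm. 1.1 ∕ Cor. 1.2), **`isZariskiClosedOnPoints_determinationLocus_of_sheets_of_compactification`**
  (Cor. 1.3), **`isZariskiClosedOnPoints_translateLocus_line_of_sheets_of_compactification`** (Cor. 1.4 for a line).
* §5 (`dim = 1`) DIRECT SUMS `Rⁱ f₁,* ℚ ⊕ Rⁱ f₂,* ℚ` of two families over the same curve, from bundled charts of `D₁` and `D₂` ALONE
  (`IsLocallyCharted.prod`, `IsLocallyFlatCharted.prod`): **`isZariskiClosedOnPoints_hodgeLocusOfNormLe_prod_of_compactification`** (Thm. 1.1: the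
  classes `(u₁, u₂)` of type `(q,q)` with `Q₁(u₁,u₁) + Q₂(u₂,u₂) ≤ K`), **`isZariskiClosedOnPoints_determinationLocus_prod_of_compactification`** (Cor. 1.3:
  BOTH determinations along ONE path class), and the `_of_compactSpace` forms over a complete curve.

HONEST SCOPE: §3–§5 are `dim S = 1`; the bundled charts (holomorphy of the period map, Schmid's nilpotent orbit theorem, unipotent local monodromy
upstairs, flat frames), the covering `φ` (the finite étale cover of the printed proof, taken as a topological covering map) and the compactifications
with disc charts are HYPOTHESES; §1–§2 need `g` universally closed with `g(ℂ)` a covering (both automatic for `g` finite étale over `S` separated).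
HC ∕ HC_CM are not touched.

## References

* [CattaniDeligneKaplan1995] E. Cattani, P. Deligne, A. Kaplan, *On the locus of Hodge classes*, J. Amer. Math. Soc. 8 (1995) 483–506: Thm. 1.1,
  Cor. 1.2, Cor. 1.3 (p. 484), Cor. 1.4 (p. 486), «Proof of 1.5 ⟹ 1.1» (p. 485), 2.3 (p. 487), (2.4) (p. 488).
* [SGA1] A. Grothendieck, M. Raynaud, *Revêtements étales et groupe fondamental* (SGA 1), LNM 224 (1971): Exp. XII Prop. 3.1 (iii), Prop. 3.2 (vi),
  Thm. 5.1.
* [MoonenOort2013Torelli] B. Moonen, F. Oort, *The Torelli locus and special subvarieties*, Handbook of Moduli II (2013), §3 Def. 4, Rem. 5 (arXiv p. 9).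
* [Hartshorne1977] R. Hartshorne, *Algebraic Geometry* (1977), Ch. II Ex. 3.14, Ch. II §4 Ex. 4.1.
* [FritzscheGrauert2002] K. Fritzsche, H. Grauert, *From Holomorphic Functions to Complex Manifolds*, GTM 213 (2002), Ch. IV §1 (cite only).
-/

noncomputable section

open scoped TensorProduct ComplexOrder
open _root_.Topology _root_.Filter Set
open AlgebraicGeometry

namespace Literature.Barriers.HodgeConjecture

open Literature.AlgebraicGeometry Literature.AlgebraicGeometry.Motives Literature.AlgebraicGeometry.HodgeTheory

universe u

variable {B : BettiHodgeData ℂ} {𝒳 𝒳₁ 𝒳₂ S S' : SchemeOver ℂ} {f : 𝒳 ⟶ S} {f₁ : 𝒳₁ ⟶ S} {f₂ : 𝒳₂ ⟶ S} {n n₁ n₂ i p : ℕ}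
variable {α ι : Type*} {ψ : α → OpenPartialHomeomorph (ComplexPoints S) ℂ} {σ : ι → ℂ → ComplexPoints S}
variable {X : Type*} [TopologicalSpace X] [CompactSpace X]

/-! ## §1 Any path-class locus descends along a finite étale cover (any dimension) -/

/-- **PATH-CLASS LOCI THROUGH A COVER, as Zariski closedness on points** (any dimension): `g : S′ ⟶ S` universally closed (finite, proper) between
`ℂ`-schemes locally of finite type with `g(ℂ)` a COVERING MAP, `s′₀ ∈ S′(ℂ)`, and ANY property `Q t γ` of path classes `γ : g(s′₀) ⇝ t` in `S(ℂ)`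
(«some determination of `u` is of type `(0,0)`», «some flat translate of `U` is a Hodge substructure», finitely many such at once, …).  If the set of
`t′ ∈ S′(ℂ)` admitting a `γ′ : s′₀ ⇝ t′` with `Q (g t′) (g ∘ γ′)` is Zariski closed on points of `S′`, then the set of `t ∈ S(ℂ)` admitting a `γ` with
`Q t γ` is Zariski closed on points of `S` — it is the IMAGE of the former under `g(ℂ)` (path lifting), and images of `Z′(ℂ)` under a universally
closed `g` are `(gZ′)(ℂ)`. [cite: CattaniDeligneKaplan1995, Cor. 1.3 (p. 484) and «Proof of 1.5 ⟹ 1.1» (p. 485)] [cite: Hartshorne1977, Ch. II §4 Ex. 4.1, Ch. II Ex. 3.14] -/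
theorem isZariskiClosedOnPoints_setOf_exists_pathClass_of_comap_covering [LocallyOfFiniteType S'.hom] [LocallyOfFiniteType S.hom] (g : S' ⟶ S)
    [UniversallyClosed g.left] (hg : IsCoveringMap (AlgPoints.map (L := ℂ) g)) (s'₀ : ComplexPoints S')
    (Q : ∀ t : ComplexPoints S, Path.Homotopic.Quotient (AlgPoints.map g s'₀) t → Prop)
    (h : IsZariskiClosedOnPoints S' {t' : ComplexPoints S' | ∃ γ' : Path.Homotopic.Quotient s'₀ t',
      Q (AlgPoints.map g t') (γ'.map (AlgPoints.mapContinuous (L := ℂ) g))}) :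
    IsZariskiClosedOnPoints S {t : ComplexPoints S | ∃ γ : Path.Homotopic.Quotient (AlgPoints.map g s'₀) t, Q t γ} := by
  have hZ := h.image_map g
  rwa [show AlgPoints.map (L := ℂ) g '' {t' : ComplexPoints S' | ∃ γ' : Path.Homotopic.Quotient s'₀ t',
      Q (AlgPoints.map g t') (γ'.map (AlgPoints.mapContinuous (L := ℂ) g))} =
      {t : ComplexPoints S | ∃ γ : Path.Homotopic.Quotient (AlgPoints.map g s'₀) t, Q t γ} from
    image_setOf_exists_pathClass_map_eq (f := AlgPoints.mapContinuous (L := ℂ) g) hg s'₀ Q] at hZ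

/-- **The same for `g : S′ ⟶ S` FINITE ÉTALE over `S` separated**: `g(ℂ)` is then a finite covering map and `g` is proper.
[cite: CattaniDeligneKaplan1995, «Proof of 1.5 ⟹ 1.1» (p. 485)] [cite: SGA1, Exp. XII Thm. 5.1 with Prop. 3.1 (iii) and Prop. 3.2 (vi)] -/
theorem isZariskiClosedOnPoints_setOf_exists_pathClass_of_comap_of_isFinite_of_etale [LocallyOfFiniteType S'.hom] [LocallyOfFiniteType S.hom]
    [IsSeparated S.hom] (g : S' ⟶ S) [IsFinite g.left] [Etale g.left] (s'₀ : ComplexPoints S')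
    (Q : ∀ t : ComplexPoints S, Path.Homotopic.Quotient (AlgPoints.map g s'₀) t → Prop)
    (h : IsZariskiClosedOnPoints S' {t' : ComplexPoints S' | ∃ γ' : Path.Homotopic.Quotient s'₀ t',
      Q (AlgPoints.map g t') (γ'.map (AlgPoints.mapContinuous (L := ℂ) g))}) :
    IsZariskiClosedOnPoints S {t : ComplexPoints S | ∃ γ : Path.Homotopic.Quotient (AlgPoints.map g s'₀) t, Q t γ} :=
  isZariskiClosedOnPoints_setOf_exists_pathClass_of_comap_covering g
    (Literature.AlgebraicGeometry.FundamentalGroup.isCoveringMap_map_of_isFinite_of_etale_of_isSeparated g).1 s'₀ Q h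

/-! ## §2 Corollary 1.4 through a finite étale cover (any dimension) -/

/-- **Cattani–Deligne–Kaplan, COROLLARY 1.4 THROUGH A COVER** (any dimension): for `g : S′ ⟶ S` universally closed with `g(ℂ)` a covering map, a
rational subspace `U ⊆ V_{g(s′₀)} = (g(ℂ)^*V)_{s′₀}`: if the set of `t′ ∈ S′(ℂ)` where some flat translate of `U` is a sub-Hodge structure of
`(g(ℂ)^*V)_{t′}` is Zariski closed on points of `S′`, so is, on `S`, the set of `t ∈ S(ℂ)` where some flat translate of `U` is a sub-Hodge structure
of `V_t` (its image). [cite: CattaniDeligneKaplan1995, Cor. 1.4 (p. 486), «Proof of 1.5 ⟹ 1.1» (p. 485)] [cite: Hartshorne1977, Ch. II §4 Ex. 4.1, Ch. II Ex. 3.14] -/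
theorem isZariskiClosedOnPoints_translateLocus_of_comap_covering [LocallyOfFiniteType S'.hom] [LocallyOfFiniteType S.hom] (g : S' ⟶ S)
    [UniversallyClosed g.left] (hg : IsCoveringMap (AlgPoints.map (L := ℂ) g)) {w : ℤ} (D : VHSData (ComplexPoints S) w)
    {s'₀ : ComplexPoints S'} (U : Submodule ℚ (D.V.fiber (AlgPoints.map g s'₀)))
    (h : IsZariskiClosedOnPoints S' {t' : ComplexPoints S' | ∃ γ' : Path.Homotopic.Quotient s'₀ t',
      ∃ W : HodgeStructure.SubHodgeStructure ((D.comap (AlgPoints.mapContinuous (L := ℂ) g)).hodge t'),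
        W.toSubmodule = U.map ((D.comap (AlgPoints.mapContinuous (L := ℂ) g)).V.transport γ')}) :
    IsZariskiClosedOnPoints S {t : ComplexPoints S | ∃ γ : Path.Homotopic.Quotient (AlgPoints.map g s'₀) t,
      ∃ W : HodgeStructure.SubHodgeStructure (D.hodge t), W.toSubmodule = U.map (D.V.transport γ)} :=
  isZariskiClosedOnPoints_setOf_exists_pathClass_of_comap_covering g hg s'₀
    (fun t γ => ∃ W : HodgeStructure.SubHodgeStructure (D.hodge t), W.toSubmodule = U.map (D.V.transport γ)) h

/-- **The same for `g` FINITE ÉTALE over `S` separated.** [cite: CattaniDeligneKaplan1995, Cor. 1.4 (p. 486), «Proof of 1.5 ⟹ 1.1» (p. 485)]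
[cite: SGA1, Exp. XII Thm. 5.1 with Prop. 3.1 (iii) and Prop. 3.2 (vi)] -/
theorem isZariskiClosedOnPoints_translateLocus_of_comap_of_isFinite_of_etale [LocallyOfFiniteType S'.hom] [LocallyOfFiniteType S.hom]
    [IsSeparated S.hom] (g : S' ⟶ S) [IsFinite g.left] [Etale g.left] {w : ℤ} (D : VHSData (ComplexPoints S) w) {s'₀ : ComplexPoints S'}
    (U : Submodule ℚ (D.V.fiber (AlgPoints.map g s'₀)))
    (h : IsZariskiClosedOnPoints S' {t' : ComplexPoints S' | ∃ γ' : Path.Homotopic.Quotient s'₀ t',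
      ∃ W : HodgeStructure.SubHodgeStructure ((D.comap (AlgPoints.mapContinuous (L := ℂ) g)).hodge t'),
        W.toSubmodule = U.map ((D.comap (AlgPoints.mapContinuous (L := ℂ) g)).V.transport γ')}) :
    IsZariskiClosedOnPoints S {t : ComplexPoints S | ∃ γ : Path.Homotopic.Quotient (AlgPoints.map g s'₀) t,
      ∃ W : HodgeStructure.SubHodgeStructure (D.hodge t), W.toSubmodule = U.map (D.V.transport γ)} :=
  isZariskiClosedOnPoints_translateLocus_of_comap_covering g
    (Literature.AlgebraicGeometry.FundamentalGroup.isCoveringMap_map_of_isFinite_of_etale_of_isSeparated g).1 D U h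

/-- **COR. 1.4 FOR A FINITE COLLECTION OF SUBSPACES `U_m ⊆ (V_m)_{g(s′₀)}` IN FINITELY MANY VARIATIONS, ONE PATH CLASS FOR ALL, THROUGH A COVER** (any
dimension; «the image of this locus in `S`»). [cite: CattaniDeligneKaplan1995, Cor. 1.4 (p. 486), «Proof of 1.5 ⟹ 1.1» (p. 485)]
[cite: MoonenOort2013Torelli, §3 Def. 4 (arXiv p. 9)] [cite: Hartshorne1977, Ch. II §4 Ex. 4.1, Ch. II Ex. 3.14] -/
theorem isZariskiClosedOnPoints_setOf_exists_forall_subHodgeStructure_translate_of_comap_covering [LocallyOfFiniteType S'.hom]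
    [LocallyOfFiniteType S.hom] (g : S' ⟶ S) [UniversallyClosed g.left] (hg : IsCoveringMap (AlgPoints.map (L := ℂ) g)) {ι' : Type*}
    {w : ι' → ℤ} (D : (m : ι') → VHSData (ComplexPoints S) (w m)) {s'₀ : ComplexPoints S'}
    (U : (m : ι') → Submodule ℚ ((D m).V.fiber (AlgPoints.map g s'₀)))
    (h : IsZariskiClosedOnPoints S' {t' : ComplexPoints S' | ∃ γ' : Path.Homotopic.Quotient s'₀ t', ∀ m,
      ∃ W : HodgeStructure.SubHodgeStructure (((D m).comap (AlgPoints.mapContinuous (L := ℂ) g)).hodge t'),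
        W.toSubmodule = (U m).map (((D m).comap (AlgPoints.mapContinuous (L := ℂ) g)).V.transport γ')}) :
    IsZariskiClosedOnPoints S {t : ComplexPoints S | ∃ γ : Path.Homotopic.Quotient (AlgPoints.map g s'₀) t, ∀ m,
      ∃ W : HodgeStructure.SubHodgeStructure ((D m).hodge t), W.toSubmodule = (U m).map ((D m).V.transport γ)} :=
  isZariskiClosedOnPoints_setOf_exists_pathClass_of_comap_covering g hg s'₀
    (fun t γ => ∀ m, ∃ W : HodgeStructure.SubHodgeStructure ((D m).hodge t), W.toSubmodule = (U m).map ((D m).V.transport γ)) h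

/-! ## §3 Corollary 1.4 on `S` from bundled flat charts of the pull-back to a cover by a punctured compact curve -/

/-- **Cattani–Deligne–Kaplan, COROLLARY 1.4 FOR A RATIONAL LINE, THROUGH A SURJECTIVE COVERING MAP FROM A PUNCTURED COMPACT CURVE, as Zariski closedness
on points** («replace `S` by a finite etale covering», then «`U_ℚ` is a Hodge substructure if and only if `e` is of type `(0,0)`, and one applies 1.3»):
`D : GeometricVHSData B f n (2p)` on `S(ℂ)`, `S` locally of finite type; `φ : T → S(ℂ)` a SURJECTIVE COVERING MAP with `T` preconnected, `φ^*D`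
locally flat-charted by discs `ψ′ a` covering `T` and ends `σ′ i` read off a compactification `j : T ↪ X` with disc charts `φc i` at the punctures;
`u₀ ≠ 0` integral at `φ(s′₀)`.  Then **the set of `t ∈ S(ℂ)` such that SOME flat translate `γ · (ℚ·u₀)` underlies a sub-Hodge structure of `V_t` is
the set of complex points of a Zariski-closed subset of `S`.** [cite: CattaniDeligneKaplan1995, Cor. 1.4 (p. 486), Cor. 1.3 (p. 484),
«Proof of 1.5 ⟹ 1.1» (p. 485), 2.3 (p. 487)] [cite: Hartshorne1977, Ch. II Ex. 3.14] -/
theorem isZariskiClosedOnPoints_translateLocus_line_of_isLocallyFlatCharted_cover_of_compactification [LocallyOfFiniteType S.hom] {T : Type}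
    [TopologicalSpace T] [PreconnectedSpace T] (φ : C(T, ComplexPoints S)) (hφc : IsCoveringMap φ) (hφ : Function.Surjective φ)
    (D : GeometricVHSData B f n (2 * p)) {α' ι' : Type*} {ψ' : α' → OpenPartialHomeomorph T ℂ} {σ' : ι' → ℂ → T}
    (h : (D.toVHSData.comap φ).IsLocallyFlatCharted ψ' σ') {s'₀ : T} {u₀ : D.VZ.fiber (φ s'₀)} (hu₀ : u₀ ≠ 0)
    (hcov : ∀ x : T, ∃ a, x ∈ (ψ' a).source) (A : ι' → ℝ)
    {j : T → X} (hj : IsEmbedding j) (pt : ι' → X) (hpS : ∀ i, pt i ∉ range j) (hcovX : ∀ x : X, x ∉ range j → ∃ i, x = pt i)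
    (φc : ι' → OpenPartialHomeomorph X ℂ) (hp : ∀ i, pt i ∈ (φc i).source) (hφp : ∀ i, φc i (pt i) = 0)
    (hball : ∀ i, Metric.ball (0 : ℂ) (Real.exp (-(2 * Real.pi * A i))) ⊆ (φc i).target)
    (hσ : ∀ (i : ι') (z : ℂ), A i < z.im → j (σ' i z) = (φc i).symm (Complex.exp (2 * Real.pi * Complex.I * z))) :
    IsZariskiClosedOnPoints S
      {t : ComplexPoints S | ∃ γ : Path.Homotopic.Quotient (φ s'₀) t, ∃ W : HodgeStructure.SubHodgeStructure (D.hodge t),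
        W.toSubmodule = (ℚ ∙ D.toRat (φ s'₀) u₀).map (D.V.transport γ)} :=
  isZariskiClosedOnPoints_of_eq_univ_or_finite
    (VHSData.IsLocallyFlatCharted.translateLocus_line_eq_univ_or_finite_of_comap_covering_of_compactification φ hφc hφ h
      (natCast_add_self_eq_natCast_two_mul p) hu₀ hcov A hj pt hpS hcovX φc hp hφp hball hσ)

/-- **COROLLARY 1.4 FOR A RATIONAL SUBSPACE `U ⊆ Hⁱ(𝒳_{φ(s′₀)}; ℚ)` OF DIMENSION `d`, THROUGH A SURJECTIVE COVERING MAP FROM A PUNCTURED COMPACT CURVE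
CARRYING FLAT CHARTS OF `⋀ᵈ(φ^*D) = φ^*(⋀ᵈD)`, as Zariski closedness on points** (`P + P = d·i`; «reduces us to the one-dimensional case»).
[cite: CattaniDeligneKaplan1995, Cor. 1.4 (p. 486), Cor. 1.3 (p. 484), «Proof of 1.5 ⟹ 1.1» (p. 485), 2.3 (p. 487)] [cite: Hartshorne1977, Ch. II Ex. 3.14] -/
theorem isZariskiClosedOnPoints_translateLocus_of_isLocallyFlatCharted_exteriorPower_cover_of_compactification [LocallyOfFiniteType S.hom]
    {T : Type} [TopologicalSpace T] [PreconnectedSpace T] (φ : C(T, ComplexPoints S)) (hφc : IsCoveringMap φ) (hφ : Function.Surjective φ)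
    (D : GeometricVHSData B f n i) {α' ι' : Type*} {ψ' : α' → OpenPartialHomeomorph T ℂ} {σ' : ι' → ℂ → T} {d : ℕ}
    (h : ((D.toVHSData.comap φ).exteriorPower d).IsLocallyFlatCharted ψ' σ') {P : ℤ} (hP : P + P = d * (i : ℤ)) {s'₀ : T}
    (U : Submodule ℚ (D.V.fiber (φ s'₀))) (hd : Module.finrank ℚ U = d) (hcov : ∀ x : T, ∃ a, x ∈ (ψ' a).source) (A : ι' → ℝ)
    {j : T → X} (hj : IsEmbedding j) (pt : ι' → X) (hpS : ∀ i, pt i ∉ range j) (hcovX : ∀ x : X, x ∉ range j → ∃ i, x = pt i)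
    (φc : ι' → OpenPartialHomeomorph X ℂ) (hp : ∀ i, pt i ∈ (φc i).source) (hφp : ∀ i, φc i (pt i) = 0)
    (hball : ∀ i, Metric.ball (0 : ℂ) (Real.exp (-(2 * Real.pi * A i))) ⊆ (φc i).target)
    (hσ : ∀ (i : ι') (z : ℂ), A i < z.im → j (σ' i z) = (φc i).symm (Complex.exp (2 * Real.pi * Complex.I * z))) :
    IsZariskiClosedOnPoints S
      {t : ComplexPoints S | ∃ γ : Path.Homotopic.Quotient (φ s'₀) t, ∃ W : HodgeStructure.SubHodgeStructure (D.hodge t),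
        W.toSubmodule = U.map (D.V.transport γ)} :=
  isZariskiClosedOnPoints_of_eq_univ_or_finite
    (VHSData.translateLocus_eq_univ_or_finite_of_isLocallyFlatCharted_exteriorPower_comap_covering_of_compactification φ hφc hφ h hP U hd
      hcov A hj pt hpS hcovX φc hp hφp hball hσ)

/-- **COROLLARY 1.4 FOR FINITELY MANY RATIONAL LINES `ℚ·u_m ⊆ Hⁱ(𝒳_{φ(s′₀)}; ℚ)` AT ONCE (`i = 2p`), THROUGH A SURJECTIVE COVERING MAP FROM A PUNCTURED
COMPACT CURVE CARRYING FLAT CHARTS OF `φ^*D`, as Zariski closedness on points.** [cite: CattaniDeligneKaplan1995, Cor. 1.4 (p. 486), Cor. 1.3 (p. 484),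
«Proof of 1.5 ⟹ 1.1» (p. 485), 2.3 (p. 487)] [cite: MoonenOort2013Torelli, §3 Def. 4 and Rem. 5 (arXiv p. 9)] [cite: Hartshorne1977, Ch. II Ex. 3.14] -/
theorem isZariskiClosedOnPoints_setOf_exists_forall_subHodgeStructure_translate_line_of_cover_of_compactification [LocallyOfFiniteType S.hom]
    {T : Type} [TopologicalSpace T] [PreconnectedSpace T] (φ : C(T, ComplexPoints S)) (hφc : IsCoveringMap φ) (hφ : Function.Surjective φ)
    (D : GeometricVHSData B f n (2 * p)) {α' ι' : Type*} {ψ' : α' → OpenPartialHomeomorph T ℂ} {σ' : ι' → ℂ → T}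
    (h : (D.toVHSData.comap φ).IsLocallyFlatCharted ψ' σ') {ι₂ : Type*} [Finite ι₂] {s'₀ : T} {u : ι₂ → D.VZ.fiber (φ s'₀)}
    (hu : ∀ m, u m ≠ 0) (hcov : ∀ x : T, ∃ a, x ∈ (ψ' a).source) (A : ι' → ℝ)
    {j : T → X} (hj : IsEmbedding j) (pt : ι' → X) (hpS : ∀ i, pt i ∉ range j) (hcovX : ∀ x : X, x ∉ range j → ∃ i, x = pt i)
    (φc : ι' → OpenPartialHomeomorph X ℂ) (hp : ∀ i, pt i ∈ (φc i).source) (hφp : ∀ i, φc i (pt i) = 0)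
    (hball : ∀ i, Metric.ball (0 : ℂ) (Real.exp (-(2 * Real.pi * A i))) ⊆ (φc i).target)
    (hσ : ∀ (i : ι') (z : ℂ), A i < z.im → j (σ' i z) = (φc i).symm (Complex.exp (2 * Real.pi * Complex.I * z))) :
    IsZariskiClosedOnPoints S
      {t : ComplexPoints S | ∃ γ : Path.Homotopic.Quotient (φ s'₀) t, ∀ m, ∃ W : HodgeStructure.SubHodgeStructure (D.hodge t),
        W.toSubmodule = (ℚ ∙ D.toRat (φ s'₀) (u m)).map (D.V.transport γ)} :=
  isZariskiClosedOnPoints_of_eq_univ_or_finite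
    (VHSData.IsLocallyFlatCharted.setOf_exists_forall_subHodgeStructure_translate_line_eq_univ_or_finite_of_comap_covering φ hφc hφ h
      (natCast_add_self_eq_natCast_two_mul p) hu hcov A (Literature.Topology.isOpen_image_ends hj φc A hball σ' hσ)
      (Literature.Topology.exists_isCompact_core hj pt hpS hcovX φc hp hφp A hball σ' hσ) (continuousOn_end_lifts hj φc A hball σ' hσ))

/-- **COROLLARY 1.4 FOR FINITELY MANY RATIONAL SUBSPACES `U_m ⊆ Hⁱ(𝒳_{φ(s′₀)}; ℚ)` OF DIMENSIONS `d_m` AT ONCE, THROUGH A SURJECTIVE COVERING MAP FROM A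
PUNCTURED COMPACT CURVE CARRYING FLAT CHARTS OF THE `⋀^{d_m}(φ^*D)`, as Zariski closedness on points** (`P m + P m = d_m·i`).
[cite: CattaniDeligneKaplan1995, Cor. 1.4 (p. 486), Cor. 1.3 (p. 484), «Proof of 1.5 ⟹ 1.1» (p. 485), 2.3 (p. 487)]
[cite: MoonenOort2013Torelli, §3 Def. 4 (arXiv p. 9)] [cite: Hartshorne1977, Ch. II Ex. 3.14] -/
theorem isZariskiClosedOnPoints_setOf_exists_forall_subHodgeStructure_translate_of_exteriorPower_cover_of_compactification
    [LocallyOfFiniteType S.hom] {T : Type} [TopologicalSpace T] [PreconnectedSpace T] (φ : C(T, ComplexPoints S)) (hφc : IsCoveringMap φ)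
    (hφ : Function.Surjective φ) (D : GeometricVHSData B f n i) {α' ι' : Type*} {ψ' : α' → OpenPartialHomeomorph T ℂ} {σ' : ι' → ℂ → T}
    {ι₂ : Type*} [Finite ι₂] {d : ι₂ → ℕ} (h : ∀ m, ((D.toVHSData.comap φ).exteriorPower (d m)).IsLocallyFlatCharted ψ' σ') {P : ι₂ → ℤ}
    (hP : ∀ m, P m + P m = d m * (i : ℤ)) {s'₀ : T} (U : ι₂ → Submodule ℚ (D.V.fiber (φ s'₀))) (hd : ∀ m, Module.finrank ℚ (U m) = d m)
    (hcov : ∀ x : T, ∃ a, x ∈ (ψ' a).source) (A : ι' → ℝ)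
    {j : T → X} (hj : IsEmbedding j) (pt : ι' → X) (hpS : ∀ i, pt i ∉ range j) (hcovX : ∀ x : X, x ∉ range j → ∃ i, x = pt i)
    (φc : ι' → OpenPartialHomeomorph X ℂ) (hp : ∀ i, pt i ∈ (φc i).source) (hφp : ∀ i, φc i (pt i) = 0)
    (hball : ∀ i, Metric.ball (0 : ℂ) (Real.exp (-(2 * Real.pi * A i))) ⊆ (φc i).target)
    (hσ : ∀ (i : ι') (z : ℂ), A i < z.im → j (σ' i z) = (φc i).symm (Complex.exp (2 * Real.pi * Complex.I * z))) :
    IsZariskiClosedOnPoints S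
      {t : ComplexPoints S | ∃ γ : Path.Homotopic.Quotient (φ s'₀) t, ∀ m, ∃ W : HodgeStructure.SubHodgeStructure (D.hodge t),
        W.toSubmodule = (U m).map (D.V.transport γ)} :=
  isZariskiClosedOnPoints_of_eq_univ_or_finite
    (VHSData.setOf_exists_forall_subHodgeStructure_translate_eq_univ_or_finite_of_exteriorPower_comap_covering φ hφc hφ h hP U hd hcov A
      (Literature.Topology.isOpen_image_ends hj φc A hball σ' hσ) (Literature.Topology.exists_isCompact_core hj pt hpS hcovX φc hp hφp A hball σ' hσ)
      (continuousOn_end_lifts hj φc A hball σ' hσ))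

/-! ## §4 From interior charts of `D` downstairs and puncture charts of `φ^*D` upstairs only -/

/-- **Cattani–Deligne–Kaplan, THEOREM 1.1 ∕ COROLLARY 1.2 AS THE BARRIER PROPERTY, FROM INTERIOR CHARTS OF `D` ON `S(ℂ)` AND PUNCTURE CHARTS OF `φ^*D`
ON A COVERING `φ : T → S(ℂ)` BY A PUNCTURED COMPACT CURVE** («replace `S` by a finite etale covering» makes the local monodromy at infinity unipotent
UPSTAIRS; the interior analysis is local on `S`): `φ` continuous surjective with sheets `e_b` (`e_b = φ` on their sources, covering `T`; `T`
preconnected), discs `ψ_a` covering `S(ℂ)` with interior period charts of `D` on small balls around every point, unipotent puncture charts of `φ^*D`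
along the ends `σ′ i` of `T` read off a compactification `j : T ↪ X`.  Then **`CattaniDeligneKaplan1995_hodgeLocus_algebraicFor B D`**.
[cite: CattaniDeligneKaplan1995, Thm. 1.1, Cor. 1.2 (p. 484), «Proof of 1.5 ⟹ 1.1» (p. 485), 2.3 (p. 487), (2.4) (p. 488)]
[cite: FritzscheGrauert2002, Ch. IV §1] [cite: Hartshorne1977, Ch. II Ex. 3.14] -/
theorem CattaniDeligneKaplan1995_hodgeLocus_algebraicFor_of_sheets_of_compactification [LocallyOfFiniteType S.hom] {T : Type}
    [TopologicalSpace T] [PreconnectedSpace T] (φ : C(T, ComplexPoints S)) (hφ : Function.Surjective φ) (D : GeometricVHSData B f n (2 * p))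
    {αS β ι' : Type*} (ψS : αS → OpenPartialHomeomorph (ComplexPoints S) ℂ) (E : β → OpenPartialHomeomorph T (ComplexPoints S))
    (hE : ∀ b x, E b x = φ x) (hcov : ∀ y : ComplexPoints S, ∃ a, y ∈ (ψS a).source) (hcov' : ∀ x : T, ∃ b, x ∈ (E b).source)
    (hint : ∀ a, ∀ y ∈ (ψS a).source, ∃ r > 0, Metric.ball (ψS a y) r ⊆ (ψS a).target ∧
      ∃ (V : Type) (_ : AddCommGroup V) (_ : Module ℚ V) (_ : FiniteDimensional ℚ V) (H₀ : HodgeStructure V ((2 * p : ℕ) : ℤ))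
        (P₀ : H₀.Polarization), Nonempty (D.toVHSData.InteriorChart (Literature.Topology.restrBall (ψS a) y r) P₀))
    {σ' : ι' → ℂ → T}
    (hpunct : ∀ i, ∃ (V : Type) (_ : AddCommGroup V) (_ : Module ℚ V) (_ : FiniteDimensional ℚ V)
      (L : PolarizedLimitMixedHodgeStructure V ((2 * p : ℕ) : ℤ)), Nonempty ((D.toVHSData.comap φ).PunctureChart (σ' i) L))
    (A : ι' → ℝ) {j : T → X} (hj : IsEmbedding j) (pt : ι' → X) (hpS : ∀ i, pt i ∉ range j) (hcovX : ∀ x : X, x ∉ range j → ∃ i, x = pt i)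
    (φc : ι' → OpenPartialHomeomorph X ℂ) (hp : ∀ i, pt i ∈ (φc i).source) (hφp : ∀ i, φc i (pt i) = 0)
    (hball : ∀ i, Metric.ball (0 : ℂ) (Real.exp (-(2 * Real.pi * A i))) ⊆ (φc i).target)
    (hσ : ∀ (i : ι') (z : ℂ), A i < z.im → j (σ' i z) = (φc i).symm (Complex.exp (2 * Real.pi * Complex.I * z))) :
    CattaniDeligneKaplan1995_hodgeLocus_algebraicFor B D :=
  CattaniDeligneKaplan1995_hodgeLocus_algebraicFor_of_forall_eq_univ_or_finite D fun K =>
    D.toVHSData.hodgeLocusOfNormLe_eq_univ_or_finite_of_sheets φ ψS E hE hφ hcov hcov' hint hpunct (natCast_add_self_eq_natCast_two_mul p) K A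
      (Literature.Topology.isOpen_image_ends hj φc A hball σ' hσ) (Literature.Topology.exists_isCompact_core hj pt hpS hcovX φc hp hφp A hball σ' hσ)

/-- **COROLLARY 1.3 FROM FLAT INTERIOR CHARTS OF `D` ON `S(ℂ)` AND FLAT PUNCTURE CHARTS OF `φ^*D` ON A COVERING BY A PUNCTURED COMPACT CURVE, as Zariski
closedness on points**: `φ : T → S(ℂ)` a surjective COVERING MAP with sheets `e_b`, `q + q = i`, `u₀ ∈ Hⁱ(𝒳_{φ(s′₀)})_ℤ`; the set of `t ∈ S(ℂ)` where
SOME determination `γ · u₀` is of type `(q,q)` is the set of complex points of a Zariski-closed subset of `S`.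
[cite: CattaniDeligneKaplan1995, Cor. 1.3 (p. 484), «Proof of 1.5 ⟹ 1.1» (p. 485), 2.3 (p. 487), (2.4) (p. 488)] [cite: FritzscheGrauert2002, Ch. IV §1]
[cite: Hartshorne1977, Ch. II Ex. 3.14] -/
theorem isZariskiClosedOnPoints_determinationLocus_of_sheets_of_compactification [LocallyOfFiniteType S.hom] {T : Type} [TopologicalSpace T]
    [PreconnectedSpace T] (φ : C(T, ComplexPoints S)) (hφc : IsCoveringMap φ) (hφ : Function.Surjective φ) (D : GeometricVHSData B f n i)
    {αS β ι' : Type*} (ψS : αS → OpenPartialHomeomorph (ComplexPoints S) ℂ) (E : β → OpenPartialHomeomorph T (ComplexPoints S))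
    (hE : ∀ b x, E b x = φ x) (hcov : ∀ y : ComplexPoints S, ∃ a, y ∈ (ψS a).source) (hcov' : ∀ x : T, ∃ b, x ∈ (E b).source)
    (hint : ∀ a, ∀ y ∈ (ψS a).source, ∃ r > 0, Metric.ball (ψS a y) r ⊆ (ψS a).target ∧
      ∃ (V : Type) (_ : AddCommGroup V) (_ : Module ℚ V) (_ : FiniteDimensional ℚ V) (H₀ : HodgeStructure V (i : ℤ)) (P₀ : H₀.Polarization)
        (C : D.toVHSData.InteriorChart (Literature.Topology.restrBall (ψS a) y r) P₀), C.IsFlat)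
    {σ' : ι' → ℂ → T}
    (hpunct : ∀ i', ∃ (V : Type) (_ : AddCommGroup V) (_ : Module ℚ V) (_ : FiniteDimensional ℚ V)
      (L : PolarizedLimitMixedHodgeStructure V (i : ℤ)) (C : (D.toVHSData.comap φ).PunctureChart (σ' i') L), C.IsFlat)
    {q : ℤ} (hq : q + q = i) {s'₀ : T} (u₀ : D.VZ.fiber (φ s'₀)) (A : ι' → ℝ)
    {j : T → X} (hj : IsEmbedding j) (pt : ι' → X) (hpS : ∀ i, pt i ∉ range j) (hcovX : ∀ x : X, x ∉ range j → ∃ i, x = pt i)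
    (φc : ι' → OpenPartialHomeomorph X ℂ) (hp : ∀ i, pt i ∈ (φc i).source) (hφp : ∀ i, φc i (pt i) = 0)
    (hball : ∀ i, Metric.ball (0 : ℂ) (Real.exp (-(2 * Real.pi * A i))) ⊆ (φc i).target)
    (hσ : ∀ (i : ι') (z : ℂ), A i < z.im → j (σ' i z) = (φc i).symm (Complex.exp (2 * Real.pi * Complex.I * z))) :
    IsZariskiClosedOnPoints S
      {t : ComplexPoints S | ∃ γ : Path.Homotopic.Quotient (φ s'₀) t, D.IsHodgeAt t q (D.VZ.transport γ u₀)} :=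
  isZariskiClosedOnPoints_of_eq_univ_or_finite
    (D.toVHSData.determinationLocus_eq_univ_or_finite_of_sheets φ ψS E hE hφc hφ hcov hcov' hint hpunct hq u₀ A
      (Literature.Topology.isOpen_image_ends hj φc A hball σ' hσ) (Literature.Topology.exists_isCompact_core hj pt hpS hcovX φc hp hφp A hball σ' hσ)
      (continuousOn_end_lifts hj φc A hball σ' hσ))

/-- **COROLLARY 1.4 FOR A RATIONAL LINE `ℚ·u₀` (`i = 2p`) FROM FLAT INTERIOR CHARTS OF `D` ON `S(ℂ)` AND FLAT PUNCTURE CHARTS OF `φ^*D` ON A COVERING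
BY A PUNCTURED COMPACT CURVE, as Zariski closedness on points.** [cite: CattaniDeligneKaplan1995, Cor. 1.4 (p. 486), Cor. 1.3 (p. 484),
«Proof of 1.5 ⟹ 1.1» (p. 485), 2.3 (p. 487), (2.4) (p. 488)] [cite: FritzscheGrauert2002, Ch. IV §1] [cite: Hartshorne1977, Ch. II Ex. 3.14] -/
theorem isZariskiClosedOnPoints_translateLocus_line_of_sheets_of_compactification [LocallyOfFiniteType S.hom] {T : Type} [TopologicalSpace T]
    [PreconnectedSpace T] (φ : C(T, ComplexPoints S)) (hφc : IsCoveringMap φ) (hφ : Function.Surjective φ)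
    (D : GeometricVHSData B f n (2 * p)) {αS β ι' : Type*} (ψS : αS → OpenPartialHomeomorph (ComplexPoints S) ℂ)
    (E : β → OpenPartialHomeomorph T (ComplexPoints S)) (hE : ∀ b x, E b x = φ x) (hcov : ∀ y : ComplexPoints S, ∃ a, y ∈ (ψS a).source)
    (hcov' : ∀ x : T, ∃ b, x ∈ (E b).source)
    (hint : ∀ a, ∀ y ∈ (ψS a).source, ∃ r > 0, Metric.ball (ψS a y) r ⊆ (ψS a).target ∧
      ∃ (V : Type) (_ : AddCommGroup V) (_ : Module ℚ V) (_ : FiniteDimensional ℚ V) (H₀ : HodgeStructure V ((2 * p : ℕ) : ℤ))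
        (P₀ : H₀.Polarization) (C : D.toVHSData.InteriorChart (Literature.Topology.restrBall (ψS a) y r) P₀), C.IsFlat)
    {σ' : ι' → ℂ → T}
    (hpunct : ∀ i, ∃ (V : Type) (_ : AddCommGroup V) (_ : Module ℚ V) (_ : FiniteDimensional ℚ V)
      (L : PolarizedLimitMixedHodgeStructure V ((2 * p : ℕ) : ℤ)) (C : (D.toVHSData.comap φ).PunctureChart (σ' i) L), C.IsFlat)
    {s'₀ : T} {u₀ : D.VZ.fiber (φ s'₀)} (hu₀ : u₀ ≠ 0) (A : ι' → ℝ)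
    {j : T → X} (hj : IsEmbedding j) (pt : ι' → X) (hpS : ∀ i, pt i ∉ range j) (hcovX : ∀ x : X, x ∉ range j → ∃ i, x = pt i)
    (φc : ι' → OpenPartialHomeomorph X ℂ) (hp : ∀ i, pt i ∈ (φc i).source) (hφp : ∀ i, φc i (pt i) = 0)
    (hball : ∀ i, Metric.ball (0 : ℂ) (Real.exp (-(2 * Real.pi * A i))) ⊆ (φc i).target)
    (hσ : ∀ (i : ι') (z : ℂ), A i < z.im → j (σ' i z) = (φc i).symm (Complex.exp (2 * Real.pi * Complex.I * z))) :
    IsZariskiClosedOnPoints S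
      {t : ComplexPoints S | ∃ γ : Path.Homotopic.Quotient (φ s'₀) t, ∃ W : HodgeStructure.SubHodgeStructure (D.hodge t),
        W.toSubmodule = (ℚ ∙ D.toRat (φ s'₀) u₀).map (D.V.transport γ)} :=
  isZariskiClosedOnPoints_of_eq_univ_or_finite
    (VHSData.translateLocus_line_eq_univ_or_finite_of_sheets (D := D.toVHSData) φ ψS E hE hφc hφ hcov hcov' hint hpunct
      (natCast_add_self_eq_natCast_two_mul p) hu₀ A (Literature.Topology.isOpen_image_ends hj φc A hball σ' hσ)
      (Literature.Topology.exists_isCompact_core hj pt hpS hcovX φc hp hφp A hball σ' hσ) (continuousOn_end_lifts hj φc A hball σ' hσ))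

/-! ## §5 Direct sums `Rⁱ f₁,* ℚ ⊕ Rⁱ f₂,* ℚ` of two families over the same curve, from charts of the summands -/

/-- **Cattani–Deligne–Kaplan, THEOREM 1.1 FOR THE DIRECT SUM `Rⁱ f₁,* ℚ ⊕ Rⁱ f₂,* ℚ` OF TWO FAMILIES OVER THE SAME PUNCTURED COMPACT CURVE, as Zariski
closedness on points** (Theorem 1.1 is stated for an arbitrary polarized variation; charts of the sum are the direct sums of the charts of the
summands, `IsLocallyCharted.prod`): `D₁`, `D₂` of the same degree `i`, locally charted by the same discs `ψ a` (covering `S(ℂ)`) and ends `σ i′` read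
off a compactification; `q + q = i`.  Then for every `K` the set of `t ∈ S(ℂ)` carrying a NONZERO integral class `(u₁, u₂)` of type `(q,q)` with
`Q₁(u₁,u₁) + Q₂(u₂,u₂) ≤ K` is the set of complex points of a Zariski-closed subset of `S`. [cite: CattaniDeligneKaplan1995, §1, Thm. 1.1, Cor. 1.2
(p. 484), «Proof of 1.5 ⟹ 1.1» (p. 485), 2.3 (p. 487)] [cite: Hartshorne1977, Ch. II Ex. 3.14] -/
theorem isZariskiClosedOnPoints_hodgeLocusOfNormLe_prod_of_compactification [PreconnectedSpace (ComplexPoints S)] [LocallyOfFiniteType S.hom]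
    (D₁ : GeometricVHSData B f₁ n₁ i) (D₂ : GeometricVHSData B f₂ n₂ i) (h₁ : D₁.toVHSData.IsLocallyCharted ψ σ)
    (h₂ : D₂.toVHSData.IsLocallyCharted ψ σ) {q : ℤ} (hq : q + q = i) (K : ℤ) (hcov : ∀ x : ComplexPoints S, ∃ a, x ∈ (ψ a).source) (A : ι → ℝ)
    {j : ComplexPoints S → X} (hj : IsEmbedding j) (pt : ι → X) (hpS : ∀ i, pt i ∉ range j) (hcovX : ∀ x : X, x ∉ range j → ∃ i, x = pt i)
    (φ : ι → OpenPartialHomeomorph X ℂ) (hp : ∀ i, pt i ∈ (φ i).source) (hφp : ∀ i, φ i (pt i) = 0)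
    (hball : ∀ i, Metric.ball (0 : ℂ) (Real.exp (-(2 * Real.pi * A i))) ⊆ (φ i).target)
    (hσ : ∀ (i : ι) (z : ℂ), A i < z.im → j (σ i z) = (φ i).symm (Complex.exp (2 * Real.pi * Complex.I * z))) :
    IsZariskiClosedOnPoints S ((D₁.toVHSData.prod D₂.toVHSData).hodgeLocusOfNormLe q K) :=
  isZariskiClosedOnPoints_of_eq_univ_or_finite
    (VHSData.hodgeLocusOfNormLe_prod_eq_univ_or_finite_of_compactification h₁ h₂ hq K hcov A hj pt hpS hcovX φ hp hφp hball hσ)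

/-- **COROLLARY 1.3 FOR THE DIRECT SUM `Rⁱ f₁,* ℚ ⊕ Rⁱ f₂,* ℚ` OVER A PUNCTURED COMPACT CURVE, FROM FLAT CHARTS OF THE SUMMANDS, as Zariski closedness on
points**: for `u₀ = (u₁, u₂)` integral at `s₀` and `q + q = i`, the set of `t ∈ S(ℂ)` where SOME path class `γ` makes BOTH `γ · u₁` and `γ · u₂` of type
`(q,q)` is the set of complex points of a Zariski-closed subset of `S`. [cite: CattaniDeligneKaplan1995, Cor. 1.3 (p. 484), «Proof of 1.5 ⟹ 1.1» (p. 485),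
2.3 (p. 487)] [cite: Hartshorne1977, Ch. II Ex. 3.14] -/
theorem isZariskiClosedOnPoints_determinationLocus_prod_of_compactification [PreconnectedSpace (ComplexPoints S)] [LocallyOfFiniteType S.hom]
    (D₁ : GeometricVHSData B f₁ n₁ i) (D₂ : GeometricVHSData B f₂ n₂ i) (h₁ : D₁.toVHSData.IsLocallyFlatCharted ψ σ)
    (h₂ : D₂.toVHSData.IsLocallyFlatCharted ψ σ) {q : ℤ} (hq : q + q = i) {s₀ : ComplexPoints S}
    (u₀ : (D₁.toVHSData.prod D₂.toVHSData).VZ.fiber s₀) (hcov : ∀ x : ComplexPoints S, ∃ a, x ∈ (ψ a).source) (A : ι → ℝ)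
    {j : ComplexPoints S → X} (hj : IsEmbedding j) (pt : ι → X) (hpS : ∀ i, pt i ∉ range j) (hcovX : ∀ x : X, x ∉ range j → ∃ i, x = pt i)
    (φ : ι → OpenPartialHomeomorph X ℂ) (hp : ∀ i, pt i ∈ (φ i).source) (hφp : ∀ i, φ i (pt i) = 0)
    (hball : ∀ i, Metric.ball (0 : ℂ) (Real.exp (-(2 * Real.pi * A i))) ⊆ (φ i).target)
    (hσ : ∀ (i : ι) (z : ℂ), A i < z.im → j (σ i z) = (φ i).symm (Complex.exp (2 * Real.pi * Complex.I * z))) :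
    IsZariskiClosedOnPoints S
      {t : ComplexPoints S | ∃ γ : Path.Homotopic.Quotient s₀ t,
        (D₁.toVHSData.prod D₂.toVHSData).IsHodgeAt t q ((D₁.toVHSData.prod D₂.toVHSData).VZ.transport γ u₀)} :=
  isZariskiClosedOnPoints_of_eq_univ_or_finite
    (VHSData.determinationLocus_prod_eq_univ_or_finite_of_compactification h₁ h₂ hq u₀ hcov A hj pt hpS hcovX φ hp hφp hball hσ)

/-- **THEOREM 1.1 FOR `Rⁱ f₁,* ℚ ⊕ Rⁱ f₂,* ℚ` OVER A COMPLETE CURVE** (`S(ℂ)` compact, no ends: interior charts of `D₁`, `D₂` alone).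
[cite: CattaniDeligneKaplan1995, §1, Thm. 1.1 (p. 484)] [cite: Hartshorne1977, Ch. II Ex. 3.14] -/
theorem isZariskiClosedOnPoints_hodgeLocusOfNormLe_prod_of_compactSpace [CompactSpace (ComplexPoints S)] [PreconnectedSpace (ComplexPoints S)]
    [LocallyOfFiniteType S.hom] [IsEmpty ι] (D₁ : GeometricVHSData B f₁ n₁ i) (D₂ : GeometricVHSData B f₂ n₂ i)
    (h₁ : D₁.toVHSData.IsLocallyCharted ψ σ) (h₂ : D₂.toVHSData.IsLocallyCharted ψ σ) {q : ℤ} (hq : q + q = i) (K : ℤ)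
    (hcov : ∀ x : ComplexPoints S, ∃ a, x ∈ (ψ a).source) :
    IsZariskiClosedOnPoints S ((D₁.toVHSData.prod D₂.toVHSData).hodgeLocusOfNormLe q K) :=
  isZariskiClosedOnPoints_of_eq_univ_or_finite ((h₁.prod h₂).hodgeLocusOfNormLe_eq_univ_or_finite_of_compactSpace hq K hcov)

/-- **COROLLARY 1.3 FOR `Rⁱ f₁,* ℚ ⊕ Rⁱ f₂,* ℚ` OVER A COMPLETE CURVE**, from flat interior charts of `D₁`, `D₂` alone.
[cite: CattaniDeligneKaplan1995, Cor. 1.3 (p. 484)] [cite: Hartshorne1977, Ch. II Ex. 3.14] -/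
theorem isZariskiClosedOnPoints_determinationLocus_prod_of_compactSpace [CompactSpace (ComplexPoints S)] [PreconnectedSpace (ComplexPoints S)]
    [LocallyOfFiniteType S.hom] [IsEmpty ι] (D₁ : GeometricVHSData B f₁ n₁ i) (D₂ : GeometricVHSData B f₂ n₂ i)
    (h₁ : D₁.toVHSData.IsLocallyFlatCharted ψ σ) (h₂ : D₂.toVHSData.IsLocallyFlatCharted ψ σ) {q : ℤ} (hq : q + q = i) {s₀ : ComplexPoints S}
    (u₀ : (D₁.toVHSData.prod D₂.toVHSData).VZ.fiber s₀) (hcov : ∀ x : ComplexPoints S, ∃ a, x ∈ (ψ a).source) :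
    IsZariskiClosedOnPoints S
      {t : ComplexPoints S | ∃ γ : Path.Homotopic.Quotient s₀ t,
        (D₁.toVHSData.prod D₂.toVHSData).IsHodgeAt t q ((D₁.toVHSData.prod D₂.toVHSData).VZ.transport γ u₀)} :=
  isZariskiClosedOnPoints_of_eq_univ_or_finite ((h₁.prod h₂).determinationLocus_eq_univ_or_finite_of_compactSpace hq u₀ hcov)

end Literature.Barriers.HodgeConjecture

end
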